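import Mathlib
import Summits.RiemannHypothesis.RiemannHypothesis.Theorems.WeilFarCoercivityFloor
import HarnessLib

/-!
# The far-coercivity floor is attained on nonnegative test functions

Helper file (`--supports stmt-RiemannHypothesis-0098`, lead-track anchor: Weil-positivity window ladder, format-C far bound),
RH-free, pure proofs.  Seat rh-explicit-weil-1 gen9 (memo `run/shared/lean/pub/rh-explicit/rh-explicit-weil-1/FORMAT-K3.md` §10.17).
The prime-shift form `Q_a(f) = Σ 2Λ(n)/√n ∫ f(x − log n) f(x) dx` has NONNEGATIVE coefficients, so `Q_a(f) ≤ Q_a(|f|)` while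
`∫|f|² = ∫f²`: the supremum `λ_max(a) = farCoercivityFloor a` may be taken over nonnegative admissible `f` only
(`farCoercivityFloor_eq_sSup_nonneg`).  This is the "no modulation" reduction used by the perturbation route to C-XIII
(FORMAT-K3 §10.17: the orthocomplement of the PNT ground state contains Kronecker-resonant modulations `cos(ξx)·φ(x)` with
Rayleigh quotient `≈ λ_max`; on the cone `f ≥ 0` they do not occur).  Standard axioms only.
-/

set_option linter.dupNamespace false
set_option autoImplicit false

noncomputable section

open MeasureTheory Set
open scoped ArithmeticFunction.vonMangoldt

namespace Summit.RiemannHypothesis.RiemannHypothesis.Theorems.WeilFormatC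

namespace FloorLaw

variable {a : ℝ}

/-- `∫ f(x − ℓ) f(x) dx ≤ ∫ |f|(x − ℓ) |f|(x) dx` (no integrability needed: a non-integrable left side integrates to `0`). -/
theorem integral_shift_mul_le_abs (f : ℝ → ℝ) (ℓ : ℝ) :
    ∫ x, f (x - ℓ) * f x ≤ ∫ x, |f (x - ℓ)| * |f x| := by
  have h1 : ∫ x, f (x - ℓ) * f x ≤ ‖∫ x, f (x - ℓ) * f x‖ := Real.le_norm_self _
  refine h1.trans ((norm_integral_le_integral_norm _).trans (le_of_eq ?_))
  refine integral_congr_ae (Filter.Eventually.of_forall fun x ↦ ?_)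
  simp only [Real.norm_eq_abs, abs_mul]

/-- **`Q_a(f) ≤ Q_a(|f|)`**: the prime-shift form does not decrease under `f ↦ |f|`. -/
theorem primeShiftForm_le_abs (a : ℝ) (f : ℝ → ℝ) :
    primeShiftForm a f ≤ primeShiftForm a (fun x ↦ |f x|) := by
  unfold primeShiftForm
  refine Finset.sum_le_sum fun n _ ↦ ?_
  have hw : 0 ≤ 2 * ((Λ n : ℝ) / Real.sqrt n) :=
    mul_nonneg (by norm_num) (div_nonneg ArithmeticFunction.vonMangoldt_nonneg (Real.sqrt_nonneg _))
  exact mul_le_mul_of_nonneg_left (integral_shift_mul_le_abs f _) hw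

/-- The quotient set over NONNEGATIVE admissible test functions. -/
theorem primeShiftQuotients_nonneg_subset (a : ℝ) :
    {q | ∃ (f : ℝ → ℝ) (C : ℝ), Measurable f ∧ (∀ x, 0 ≤ f x) ∧ (∀ x, |f x| ≤ C) ∧ (∀ x, x ∉ Icc (-a) a → f x = 0) ∧
        0 < ∫ x, f x ^ 2 ∧ q = primeShiftForm a f / ∫ x, f x ^ 2} ⊆ primeShiftQuotients a := by
  rintro q ⟨f, C, hm, -, hC, hs, hpos, rfl⟩
  exact ⟨f, C, hm, hC, hs, hpos, rfl⟩

/-- Every quotient is dominated by the quotient of a nonnegative admissible function (namely `|f|`). -/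
theorem exists_nonneg_quotient_ge {q : ℝ} (hq : q ∈ primeShiftQuotients a) :
    ∃ q' ∈ {q | ∃ (f : ℝ → ℝ) (C : ℝ), Measurable f ∧ (∀ x, 0 ≤ f x) ∧ (∀ x, |f x| ≤ C) ∧ (∀ x, x ∉ Icc (-a) a → f x = 0) ∧
        0 < ∫ x, f x ^ 2 ∧ q = primeShiftForm a f / ∫ x, f x ^ 2}, q ≤ q' := by
  obtain ⟨f, C, hm, hC, hs, hpos, rfl⟩ := hq
  have hsq : ∀ x, |f x| ^ 2 = f x ^ 2 := fun x ↦ sq_abs _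
  have hint : ∫ x, |f x| ^ 2 = ∫ x, f x ^ 2 := integral_congr_ae (Filter.Eventually.of_forall hsq)
  refine ⟨primeShiftForm a (fun x ↦ |f x|) / ∫ x, |f x| ^ 2,
    ⟨fun x ↦ |f x|, C, continuous_abs.measurable.comp hm, fun x ↦ abs_nonneg _, fun x ↦ by rw [abs_abs]; exact hC x,
      fun x hx ↦ by simp [hs x hx], by rw [hint]; exact hpos, rfl⟩, ?_⟩
  rw [hint]
  exact div_le_div_of_nonneg_right (primeShiftForm_le_abs a f) hpos.le

/-- ★ **The floor is a supremum over nonnegative test functions**: for `a > 0`,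
`farCoercivityFloor a = sup {Q_a(f)/∫f² : f ≥ 0 admissible}`. -/
theorem farCoercivityFloor_eq_sSup_nonneg (ha : 0 < a) :
    farCoercivityFloor a = sSup {q | ∃ (f : ℝ → ℝ) (C : ℝ), Measurable f ∧ (∀ x, 0 ≤ f x) ∧ (∀ x, |f x| ≤ C) ∧
        (∀ x, x ∉ Icc (-a) a → f x = 0) ∧ 0 < ∫ x, f x ^ 2 ∧ q = primeShiftForm a f / ∫ x, f x ^ 2} := by
  set Sp := {q | ∃ (f : ℝ → ℝ) (C : ℝ), Measurable f ∧ (∀ x, 0 ≤ f x) ∧ (∀ x, |f x| ≤ C) ∧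
        (∀ x, x ∉ Icc (-a) a → f x = 0) ∧ 0 < ∫ x, f x ^ 2 ∧ q = primeShiftForm a f / ∫ x, f x ^ 2} with hSp
  have hsub : Sp ⊆ primeShiftQuotients a := primeShiftQuotients_nonneg_subset a
  have hbdd : BddAbove Sp := (primeShiftQuotients_bddAbove a).mono hsub
  obtain ⟨q₀, hq₀⟩ := primeShiftQuotients_nonempty ha
  obtain ⟨q₀', hq₀', -⟩ := exists_nonneg_quotient_ge hq₀
  have hne : Sp.Nonempty := ⟨q₀', hq₀'⟩
  refine le_antisymm ?_ (csSup_le_csSup (primeShiftQuotients_bddAbove a) hne hsub)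
  refine csSup_le (primeShiftQuotients_nonempty ha) fun q hq ↦ ?_
  obtain ⟨q', hq', hle⟩ := exists_nonneg_quotient_ge hq
  exact hle.trans (le_csSup hbdd hq')

/-- Hence a uniform shift bound over NONNEGATIVE admissible functions already bounds the floor (`a > 0`). -/
theorem farCoercivityFloor_le_of_shiftBound_nonneg {A : ℝ} (ha : 0 < a)
    (hJ : ∀ (f : ℝ → ℝ) (C : ℝ), Measurable f → (∀ x, 0 ≤ f x) → (∀ x, |f x| ≤ C) → (∀ x, x ∉ Icc (-a) a → f x = 0) →
      primeShiftForm a f ≤ A * ∫ x, f x ^ 2) :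
    farCoercivityFloor a ≤ A := by
  rw [farCoercivityFloor_eq_sSup_nonneg ha]
  obtain ⟨q₀, hq₀⟩ := primeShiftQuotients_nonempty ha
  obtain ⟨q₀', hq₀', -⟩ := exists_nonneg_quotient_ge hq₀
  refine csSup_le ⟨q₀', hq₀'⟩ ?_
  rintro q ⟨f, C, hm, h0, hC, hs, hpos, rfl⟩
  rw [div_le_iff₀ hpos]
  exact hJ f C hm h0 hC hs

end FloorLaw

end Summit.RiemannHypothesis.RiemannHypothesis.Theorems.WeilFormatC
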